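import Summits.Ventures.CertifiedManyBodySolver.Theorems.ThermalStiffnessCeilingU8b8_le_7o44.Negative.CurrentCovarianceTRBlind
import Literature.MathematicalPhysics.QuantumLattice.LatticeTori
import Summits.Ventures.CertifiedManyBodySolver.Downfold.EmeryThermalAtomicFloor
import HarnessLib

/-!
# Locality of the current covariance and the infinite-temperature rung
(negative-side helpers for the cruxes K1′ / K1 of route `TcThermcert1`)

Disprover's helpers (`--supports stmt-Ventures-24560`; crux K1′ `TcThermcert1.ThermalStiffnessCeilingU8b8_le_7o44`, line of record
`Cruxes/ThermalStiffnessCeilingU8b8_le_7o44/Lines/gauge_qbp_far_seam.lean` v1.3, bet C8 `stub_currentClustering8`; equally the K1 twin's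
C10): finding F4 of edition 2 of `Cruxes/ThermalStiffnessCeilingU8b8_le_7o44/Disproof.lean`, restated over the tree's literal operators and an
ARBITRARY coordinate predicate `p` (the line's `sectorExpect L δ β H A = gibbsState β (H.toBlock (sectorPred L δ) _) (A.toBlock _ _)` and
`bondCurrent L X y = j` are these terms, so the line can `unfold; exact`). Companion of `CurrentCovarianceTRBlind.lean` (F1).

* LOCALITY (`apply_eq_zero_of_mem_carSubalgebra`): an element of the CAR subalgebra `𝔄(S)` has no matrix element between occupation
  sets that differ outside `S` (span of Jordan–Wigner words + locality of the word action). Hence `A · j` has ZERO DIAGONAL for every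
  `A ∈ 𝔄(orbSet X)` — parity is not used — once the bond's head site is outside `X` (`diag_mul_farBond_eq_zero`), and so has `j` itself.
* INFINITE-TEMPERATURE RUNG: at `β = 0` the compressed Gibbs state is the normalised trace of the block, so the covariance of Hypothesis C
  vanishes identically off the head site (`gibbsCov_zero_fluxZeroBlock_farBond_eq_zero`), and Hypothesis C's body holds at `β = 0` for
  EVERY `U`, `n`, `ξ > 0` with `(C, k, L₀) = (4, 0, 0)` (`currentClusteringBody_beta_zero` — the line's `CurrentClustering U n 0 ξ`
  unfolded, checked `Iff.rfl`-equal to the copied definition in the crux work file). Likewise `ω_p(j) = 0` at `β = 0` for EVERY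
  Hamiltonian (`gibbsState_zero_toBlock_farBond_eq_zero`): the line's `farCutCurrent L U n 0 φ = 0` for every flux, so stub B's conclusion
  holds at `β = 0` with `ε ≡ 0` — B's hypothesis `0 < β` places `θ₁(β)`, it does not dodge a counterexample.
  READING for the bet: any failure of C8 is a finite-`β` build-up of a time-reversal-odd correlation starting from `Cov ≡ 0`.

HONEST FRAMING: finite-dimensional folklore; NO KILL of K1′, of stub B or of the bet C8 is claimed, nothing here bears on clustering at
`(U, n, β) = (8, 7/8, 8)`, and superconductivity in the Hubbard model is neither proved nor disproved by anything in this file.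
-/

noncomputable section

open scoped ComplexOrder ComplexConjugate Matrix.Norms.L2Operator
open Filter Topology Matrix Finset
open Literature.MathematicalPhysics.QuantumLattice
open Literature.Probability.LatticeModels
open Summit.Ventures.CertifiedManyBodySolver.Theorems.TcThermcert1.GaugeQbpFarSeam
open Summit.Ventures.CertifiedManyBodySolver.Theorems.TcThermcert1.CurrentCovarianceTRBlind

namespace Summit.Ventures.CertifiedManyBodySolver.Theorems.TcThermcert1.CurrentCovarianceLocality

/-! ## §1 Locality of matrix elements -/

section Locality

variable {ι : Type*} [LinearOrder ι] [Fintype ι]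

/-- **Locality of Jordan–Wigner words**: a word with letters in `S` has no matrix element between occupation sets that differ
outside `S`. [folklore] -/
theorem wordOp_apply_eq_zero_of_sdiff_ne {S : Finset ι} {w : List (JWLetter ι)} (hw : LettersIn S w)
    {s t : Finset ι} (h : s \ S ≠ t \ S) : wordOp w s t = 0 := by
  have key := congrFun (wordOp_mulVec_single w t) s
  rw [mulVec_single_one, col_apply] at key
  rw [key, Pi.smul_apply, smul_eq_mul, Pi.single_eq_of_ne, mul_zero]
  intro hs
  have ht : t ∩ S ∪ t \ S = t := sup_inf_sdiff t S
  obtain ⟨hset, hsub⟩ := wordSet_union w hw (Finset.inter_subset_right : t ∩ S ⊆ S)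
    (Finset.sdiff_disjoint : Disjoint (t \ S) S)
  refine h ?_
  rw [hs]
  conv_lhs => rw [← ht]
  rw [hset, Finset.union_sdiff_distrib, Finset.sdiff_eq_empty_iff_subset.2 hsub, Finset.empty_union, Finset.sdiff_idem]

/-- **Locality of `𝔄(S)`**: an element of the CAR subalgebra of `S` has no matrix element between occupation sets that differ
outside `S` (`𝔄(S)` is the span of the words with letters in `S`). [folklore] -/
theorem apply_eq_zero_of_mem_carSubalgebra {S : Finset ι} {A : Matrix (Finset ι) (Finset ι) ℂ}
    (hA : A ∈ carSubalgebra S) {s t : Finset ι} (h : s \ S ≠ t \ S) : A s t = 0 := by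
  refine Submodule.span_induction (p := fun M _ => M s t = 0) ?_ ?_ ?_ ?_ (mem_span_wordOp_of_mem_carSubalgebra hA)
  · rintro M ⟨w, hw, rfl⟩
    exact wordOp_apply_eq_zero_of_sdiff_ne hw h
  · rfl
  · intro x y _ _ hx hy
    rw [Matrix.add_apply, hx, hy, add_zero]
  · intro c x _ hx
    rw [Matrix.smul_apply, hx, smul_zero]

/-- A hopping `c†_o c_{o'}` INTO an orbital `o ∉ S`, `o ≠ o'`, followed by `A ∈ 𝔄(S)`, has zero diagonal. [folklore] -/
theorem diag_mul_hopping_into_eq_zero {S : Finset ι} {A : Matrix (Finset ι) (Finset ι) ℂ} (hA : A ∈ carSubalgebra S)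
    {o o' : ι} (ho : o ∉ S) (hoo' : o ≠ o') (s : Finset ι) : (A * (creation o * annihilation o')) s s = 0 := by
  rw [Matrix.mul_apply]
  refine Finset.sum_eq_zero fun t _ => ?_
  by_cases hz : (creation o * annihilation o') t s = 0
  · rw [hz, mul_zero]
  · obtain ⟨hot, -, hs⟩ := LiebTwo.creation_mul_annihilation_apply_ne_zero hz
    rw [apply_eq_zero_of_mem_carSubalgebra hA ?_, zero_mul]
    intro hst
    have h1 : o ∈ t \ S := Finset.mem_sdiff.2 ⟨hot, ho⟩
    rw [← hst, Finset.mem_sdiff, hs, Finset.mem_insert, Finset.mem_erase] at h1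
    rcases h1.1 with h | h
    · exact hoo' h
    · exact h.1 rfl

/-- A hopping `c†_{o'} c_o` OUT OF an orbital `o ∉ S`, `o ≠ o'`, followed by `A ∈ 𝔄(S)`, has zero diagonal. [folklore] -/
theorem diag_mul_hopping_outof_eq_zero {S : Finset ι} {A : Matrix (Finset ι) (Finset ι) ℂ} (hA : A ∈ carSubalgebra S)
    {o o' : ι} (ho : o ∉ S) (hoo' : o ≠ o') (s : Finset ι) : (A * (creation o' * annihilation o)) s s = 0 := by
  rw [Matrix.mul_apply]
  refine Finset.sum_eq_zero fun t _ => ?_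
  by_cases hz : (creation o' * annihilation o) t s = 0
  · rw [hz, mul_zero]
  · obtain ⟨-, hos, hs⟩ := LiebTwo.creation_mul_annihilation_apply_ne_zero hz
    rw [apply_eq_zero_of_mem_carSubalgebra hA ?_, zero_mul]
    intro hst
    have h1 : o ∈ s \ S := Finset.mem_sdiff.2 ⟨by rw [hs]; exact Finset.mem_insert_self _ _, ho⟩
    rw [hst, Finset.mem_sdiff] at h1
    exact hos (Finset.mem_erase.2 ⟨hoo', h1.1⟩)

/-- At `β = 0` the compressed Gibbs state is the normalised trace of the block: a zero-diagonal operator has expectation `0`,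
whatever the Hamiltonian and the sector. [folklore] -/
theorem gibbsState_zero_toBlock_eq_zero_of_diag {m : Type*} [Fintype m] [DecidableEq m] (p : m → Prop) [DecidablePred p]
    (H : Matrix m m ℂ) {M : Matrix m m ℂ} (hM : ∀ s, M s s = 0) : gibbsState 0 (H.toBlock p p) (M.toBlock p p) = 0 := by
  rw [gibbsState_apply, gibbsWeight_zero, one_mul]
  have h0 : (M.toBlock p p).trace = 0 := by
    simp [Matrix.trace, Matrix.toBlock_apply, hM]
  rw [h0, mul_zero]

end Locality

/-! ## §2 The plain bond current has zero diagonal off its head site -/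

section Bond

variable {Λ : Type*} [LinearOrder Λ] [Fintype Λ]

/-- **`A · j_{ab}` has zero diagonal** for `A ∈ 𝔄(orbSet X)` and the bond endpoint `a ∉ X`
(`j_{ab} = Σ_σ (−i c†_{aσ} c_{bσ} + i c†_{bσ} c_{aσ})`; for `a = b` the current is `0`). Only `carSubalgebra` is used. [folklore] -/
theorem diag_mul_farBond_eq_zero {X : Finset Λ} {A : Matrix (Finset (Orb Λ)) (Finset (Orb Λ)) ℂ}
    (hA : A ∈ carSubalgebra (orbSet X)) {a : Λ} (ha : a ∉ X) (b : Λ) (s : Finset (Orb Λ)) :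
    (A * (∑ σ : Fin 2, ((-Complex.I) • (creation (orb a σ) * annihilation (orb b σ)) +
        Complex.I • (creation (orb b σ) * annihilation (orb a σ))))) s s = 0 := by
  by_cases hab : a = b
  · subst hab
    have h0 : (∑ σ : Fin 2, ((-Complex.I) • (creation (orb a σ) * annihilation (orb a σ)) +
        Complex.I • (creation (orb a σ) * annihilation (orb a σ))) :
          Matrix (Finset (Orb Λ)) (Finset (Orb Λ)) ℂ) = 0 :=
      Finset.sum_eq_zero fun σ _ => by rw [neg_smul, neg_add_cancel]
    rw [h0, mul_zero, Matrix.zero_apply]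
  · have hoS : ∀ σ : Fin 2, orb a σ ∉ orbSet X := fun σ h => ha (mem_orbSet.1 h)
    have hne : ∀ σ : Fin 2, orb a σ ≠ orb b σ := fun σ h =>
      hab (congrArg (fun k : Orb Λ => (ofLex k).1) h)
    rw [Finset.mul_sum, Matrix.sum_apply]
    refine Finset.sum_eq_zero fun σ _ => ?_
    rw [Matrix.mul_add, Matrix.mul_smul, Matrix.mul_smul, Matrix.add_apply, Matrix.smul_apply, Matrix.smul_apply,
      diag_mul_hopping_into_eq_zero hA (hoS σ) (hne σ), diag_mul_hopping_outof_eq_zero hA (hoS σ) (hne σ),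
      smul_zero, smul_zero, add_zero]

/-- The bare bond current `j_{ab}` has zero diagonal. [folklore] -/
theorem diag_farBond_eq_zero (a b : Λ) (s : Finset (Orb Λ)) :
    (∑ σ : Fin 2, ((-Complex.I) • (creation (orb a σ) * annihilation (orb b σ)) +
        Complex.I • (creation (orb b σ) * annihilation (orb a σ))) :
          Matrix (Finset (Orb Λ)) (Finset (Orb Λ)) ℂ) s s = 0 := by
  by_cases hab : a = b
  · subst hab
    have h0 : (∑ σ : Fin 2, ((-Complex.I) • (creation (orb a σ) * annihilation (orb a σ)) +
        Complex.I • (creation (orb a σ) * annihilation (orb a σ))) :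
          Matrix (Finset (Orb Λ)) (Finset (Orb Λ)) ℂ) = 0 :=
      Finset.sum_eq_zero fun σ _ => by rw [neg_smul, neg_add_cancel]
    rw [h0, Matrix.zero_apply]
  · have hne : ∀ σ : Fin 2, orb a σ ≠ orb b σ := fun σ h =>
      hab (congrArg (fun k : Orb Λ => (ofLex k).1) h)
    rw [Matrix.sum_apply]
    refine Finset.sum_eq_zero fun σ _ => ?_
    rw [Matrix.add_apply, Matrix.smul_apply, Matrix.smul_apply, Downfold.creation_mul_annihilation_apply_self_of_ne (hne σ),
      Downfold.creation_mul_annihilation_apply_self_of_ne (hne σ).symm, smul_zero, smul_zero, add_zero]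

end Bond

/-! ## §3 Torus: the infinite-temperature rung -/

section Torus

variable (L : ℕ) [NeZero L]

/-- **At `β = 0` the covariance of Hypothesis C vanishes identically** for every `A ∈ 𝔄(orbSet X)` whose support misses the bond's
head site `(X₀, y)` — every `U`, sector `p`, side `L` (both terms are normalised traces of zero-diagonal operators). [folklore] -/
theorem gibbsCov_zero_fluxZeroBlock_farBond_eq_zero (U : ℝ) (X₀ y : ZMod L)
    (p : Finset (Orb (FermionTorus 2 L)) → Prop) [DecidablePred p]
    {X : Finset (FermionTorus 2 L)} {A : Matrix (Finset (Orb (FermionTorus 2 L))) (Finset (Orb (FermionTorus 2 L))) ℂ}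
    (hA : A ∈ carSubalgebra (orbSet X)) (ha : FermionTorus.ofTorusSite (![X₀, y] : TorusSite 2 L) ∉ X) :
    gibbsState 0 ((hubbardTorusTT'Flux L 0 U 0).toBlock p p)
          ((A * (∑ σ : Fin 2,
            ((-Complex.I) • (creation (orb (FermionTorus.ofTorusSite (![X₀, y] : TorusSite 2 L)) σ) *
                annihilation (orb (FermionTorus.ofTorusSite (![X₀ - 1, y] : TorusSite 2 L)) σ)) +
              Complex.I • (creation (orb (FermionTorus.ofTorusSite (![X₀ - 1, y] : TorusSite 2 L)) σ) *
                annihilation (orb (FermionTorus.ofTorusSite (![X₀, y] : TorusSite 2 L)) σ))))).toBlock p p)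
      - gibbsState 0 ((hubbardTorusTT'Flux L 0 U 0).toBlock p p) (A.toBlock p p)
        * gibbsState 0 ((hubbardTorusTT'Flux L 0 U 0).toBlock p p)
          ((∑ σ : Fin 2,
            ((-Complex.I) • (creation (orb (FermionTorus.ofTorusSite (![X₀, y] : TorusSite 2 L)) σ) *
                annihilation (orb (FermionTorus.ofTorusSite (![X₀ - 1, y] : TorusSite 2 L)) σ)) +
              Complex.I • (creation (orb (FermionTorus.ofTorusSite (![X₀ - 1, y] : TorusSite 2 L)) σ) *
                annihilation (orb (FermionTorus.ofTorusSite (![X₀, y] : TorusSite 2 L)) σ)))).toBlock p p) = 0 := by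
  rw [gibbsState_zero_toBlock_eq_zero_of_diag p _ (diag_mul_farBond_eq_zero hA ha _),
    gibbsState_zero_toBlock_eq_zero_of_diag p _ (diag_farBond_eq_zero _ _), mul_zero, sub_zero]

/-- **INFINITE-TEMPERATURE RUNG of Hypothesis C** — the line's `CurrentClustering U n 0 ξ`, unfolded (`sectorExpect`, `bondCurrent`,
`SectorPreserving`, `sectorPred`, `FockOp`): it holds for EVERY `U`, `n` and `ξ > 0` with `(C, k, L₀) = (4, 0, 0)`. If the head site
`(X₀, y)` lies in `X` the distance premise forces `d = 0` and the claim is the a-priori bound `‖Cov‖ ≤ 4‖A‖`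
(`norm_gibbsCov_fluxZeroBlock_farBond_le`); otherwise the covariance is `0` by locality. So the bet C8 can only fail through a
FINITE-`β` build-up of a time-reversal-odd correlation. [folklore] -/
theorem currentClusteringBody_beta_zero (U n : ℝ) {ξ : ℝ} (hξ : 0 < ξ) :
    0 < ξ ∧ ∃ C : ℝ, ∃ k L₀ : ℕ, ∀ (L : ℕ) [NeZero L], L₀ ≤ L →
      ∀ (X : Finset (FermionTorus 2 L)) (A : Matrix (Finset (Orb (FermionTorus 2 L))) (Finset (Orb (FermionTorus 2 L))) ℂ),
        A ∈ carEvenSubalgebra (orbSet X) →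
        (∀ s t : Finset (Orb (FermionTorus 2 L)),
          (s.card = 2 * ⌊(1 - (1 - n)) * (L : ℝ) ^ 2 / 2⌋₊ ∧
            2 * (s.filter fun i => (ofLex i).2 = 0).card = 2 * ⌊(1 - (1 - n)) * (L : ℝ) ^ 2 / 2⌋₊) →
          ¬ (t.card = 2 * ⌊(1 - (1 - n)) * (L : ℝ) ^ 2 / 2⌋₊ ∧
            2 * (t.filter fun i => (ofLex i).2 = 0).card = 2 * ⌊(1 - (1 - n)) * (L : ℝ) ^ 2 / 2⌋₊) →
          A s t = 0 ∧ A t s = 0) →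
        ∀ (X₀ y : ZMod L) (d : ℕ),
          (∀ x ∈ X, d ≤ torusDist x.toTorusSite ![X₀, y] ∧ d ≤ torusDist x.toTorusSite ![X₀ - 1, y]) →
          ‖gibbsState 0 ((hubbardTorusTT'Flux L 0 U 0).toBlock
                (fun s => s.card = 2 * ⌊(1 - (1 - n)) * (L : ℝ) ^ 2 / 2⌋₊ ∧
                  2 * (s.filter fun i => (ofLex i).2 = 0).card = 2 * ⌊(1 - (1 - n)) * (L : ℝ) ^ 2 / 2⌋₊)
                (fun s => s.card = 2 * ⌊(1 - (1 - n)) * (L : ℝ) ^ 2 / 2⌋₊ ∧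
                  2 * (s.filter fun i => (ofLex i).2 = 0).card = 2 * ⌊(1 - (1 - n)) * (L : ℝ) ^ 2 / 2⌋₊))
              ((A * (∑ σ : Fin 2,
                ((-Complex.I) • (creation (orb (FermionTorus.ofTorusSite (![X₀, y] : TorusSite 2 L)) σ) *
                    annihilation (orb (FermionTorus.ofTorusSite (![X₀ - 1, y] : TorusSite 2 L)) σ)) +
                  Complex.I • (creation (orb (FermionTorus.ofTorusSite (![X₀ - 1, y] : TorusSite 2 L)) σ) *
                    annihilation (orb (FermionTorus.ofTorusSite (![X₀, y] : TorusSite 2 L)) σ))))).toBlock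
                (fun s => s.card = 2 * ⌊(1 - (1 - n)) * (L : ℝ) ^ 2 / 2⌋₊ ∧
                  2 * (s.filter fun i => (ofLex i).2 = 0).card = 2 * ⌊(1 - (1 - n)) * (L : ℝ) ^ 2 / 2⌋₊)
                (fun s => s.card = 2 * ⌊(1 - (1 - n)) * (L : ℝ) ^ 2 / 2⌋₊ ∧
                  2 * (s.filter fun i => (ofLex i).2 = 0).card = 2 * ⌊(1 - (1 - n)) * (L : ℝ) ^ 2 / 2⌋₊))
            - gibbsState 0 ((hubbardTorusTT'Flux L 0 U 0).toBlock
                (fun s => s.card = 2 * ⌊(1 - (1 - n)) * (L : ℝ) ^ 2 / 2⌋₊ ∧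
                  2 * (s.filter fun i => (ofLex i).2 = 0).card = 2 * ⌊(1 - (1 - n)) * (L : ℝ) ^ 2 / 2⌋₊)
                (fun s => s.card = 2 * ⌊(1 - (1 - n)) * (L : ℝ) ^ 2 / 2⌋₊ ∧
                  2 * (s.filter fun i => (ofLex i).2 = 0).card = 2 * ⌊(1 - (1 - n)) * (L : ℝ) ^ 2 / 2⌋₊))
              (A.toBlock
                (fun s => s.card = 2 * ⌊(1 - (1 - n)) * (L : ℝ) ^ 2 / 2⌋₊ ∧
                  2 * (s.filter fun i => (ofLex i).2 = 0).card = 2 * ⌊(1 - (1 - n)) * (L : ℝ) ^ 2 / 2⌋₊)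
                (fun s => s.card = 2 * ⌊(1 - (1 - n)) * (L : ℝ) ^ 2 / 2⌋₊ ∧
                  2 * (s.filter fun i => (ofLex i).2 = 0).card = 2 * ⌊(1 - (1 - n)) * (L : ℝ) ^ 2 / 2⌋₊))
              * gibbsState 0 ((hubbardTorusTT'Flux L 0 U 0).toBlock
                (fun s => s.card = 2 * ⌊(1 - (1 - n)) * (L : ℝ) ^ 2 / 2⌋₊ ∧
                  2 * (s.filter fun i => (ofLex i).2 = 0).card = 2 * ⌊(1 - (1 - n)) * (L : ℝ) ^ 2 / 2⌋₊)
                (fun s => s.card = 2 * ⌊(1 - (1 - n)) * (L : ℝ) ^ 2 / 2⌋₊ ∧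
                  2 * (s.filter fun i => (ofLex i).2 = 0).card = 2 * ⌊(1 - (1 - n)) * (L : ℝ) ^ 2 / 2⌋₊))
              ((∑ σ : Fin 2,
                ((-Complex.I) • (creation (orb (FermionTorus.ofTorusSite (![X₀, y] : TorusSite 2 L)) σ) *
                    annihilation (orb (FermionTorus.ofTorusSite (![X₀ - 1, y] : TorusSite 2 L)) σ)) +
                  Complex.I • (creation (orb (FermionTorus.ofTorusSite (![X₀ - 1, y] : TorusSite 2 L)) σ) *
                    annihilation (orb (FermionTorus.ofTorusSite (![X₀, y] : TorusSite 2 L)) σ)))).toBlock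
                (fun s => s.card = 2 * ⌊(1 - (1 - n)) * (L : ℝ) ^ 2 / 2⌋₊ ∧
                  2 * (s.filter fun i => (ofLex i).2 = 0).card = 2 * ⌊(1 - (1 - n)) * (L : ℝ) ^ 2 / 2⌋₊)
                (fun s => s.card = 2 * ⌊(1 - (1 - n)) * (L : ℝ) ^ 2 / 2⌋₊ ∧
                  2 * (s.filter fun i => (ofLex i).2 = 0).card = 2 * ⌊(1 - (1 - n)) * (L : ℝ) ^ 2 / 2⌋₊))‖
            ≤ C * ‖A‖ * (X.card : ℝ) ^ k * Real.exp (-(d : ℝ) / ξ) := by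
  refine ⟨hξ, 4, 0, 0, fun L _ _ X A hA _ X₀ y d hd => ?_⟩
  by_cases ha : FermionTorus.ofTorusSite ![X₀, y] ∈ X
  · have hd0 : d = 0 := by
      have h := (hd _ ha).1
      rw [FermionTorus.toTorusSite_ofTorusSite, torusDist_self] at h
      exact Nat.le_zero.1 h
    subst hd0
    refine (norm_gibbsCov_fluxZeroBlock_farBond_le L U 0 X₀ y _ A).trans (le_of_eq ?_)
    simp
  · rw [gibbsCov_zero_fluxZeroBlock_farBond_eq_zero L U X₀ y _ (carEvenSubalgebra_le_carSubalgebra _ hA) ha, norm_zero]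
    positivity

/-- **At `β = 0` the sector expectation of the bond current vanishes for EVERY Hamiltonian** (in particular for every flux of the
twisted torus Hamiltonian, which enters only through `e^{−βH} = 1`): the line's `farCutCurrent L U n 0 φ = 0`, and stub B's conclusion
`PersistentCurrentVanishes U n 0 θ₁` holds with `ε ≡ 0`. [folklore] -/
theorem gibbsState_zero_toBlock_farBond_eq_zero (H : Matrix (Finset (Orb (FermionTorus 2 L))) (Finset (Orb (FermionTorus 2 L))) ℂ)
    (X₀ y : ZMod L) (p : Finset (Orb (FermionTorus 2 L)) → Prop) [DecidablePred p] :
    gibbsState 0 (H.toBlock p p)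
        ((∑ σ : Fin 2,
            ((-Complex.I) • (creation (orb (FermionTorus.ofTorusSite (![X₀, y] : TorusSite 2 L)) σ) *
                annihilation (orb (FermionTorus.ofTorusSite (![X₀ - 1, y] : TorusSite 2 L)) σ)) +
              Complex.I • (creation (orb (FermionTorus.ofTorusSite (![X₀ - 1, y] : TorusSite 2 L)) σ) *
                annihilation (orb (FermionTorus.ofTorusSite (![X₀, y] : TorusSite 2 L)) σ)))).toBlock p p) = 0 :=
  gibbsState_zero_toBlock_eq_zero_of_diag p H (diag_farBond_eq_zero _ _)

end Torus

end Summit.Ventures.CertifiedManyBodySolver.Theorems.TcThermcert1.CurrentCovarianceLocality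

end
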